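import Literature.MathematicalPhysics.QuantumFieldTheory.ConformalBootstrap3D.PointKernelK34L505Data
import Literature.MathematicalPhysics.QuantumFieldTheory.ConformalBootstrap3D.PointKernelK34L505Segs
import Literature.MathematicalPhysics.QuantumFieldTheory.ConformalBootstrap3D.PointKernelParts

/-!
# K34L505 certificate, kernel part file P27: one-cell head segments 97 in level ranges

The head cells whose kernel evaluation exceeds one `decide` are one-cell segments of `hsegsK34L505`; each is
checked by `PCert.hPartSideOK` (side conditions) and `PCert.hPartOK` per level range `[n_lo, n_lo + count)`
against an integer claim, the claims summing to `≥ 0` (`PointKernel.partsOK`); soundness is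
`PCert.hParts_sound` (`PointKernelParts`).  The part files are mutually independent (each imports only
the data file); the ranges of one cell may span several of them, and the per-cell conclusions
`hparts_i` / `hcell_i` of those cells are assembled in `PointKernelK34L505.lean`.
Estimated kernel time 222 s.
-/

set_option maxRecDepth 100000
set_option maxHeartbeats 0

namespace Literature.MathematicalPhysics.QuantumFieldTheory.ConformalBootstrap3D.PointKernelK34L505

open Literature.MathematicalPhysics.QuantumFieldTheory.ConformalBootstrap3D.PointKernel

/-- levels `[25, 36)` of segment 97: partial lower sum `≥` claim. [folklore] -/
theorem part_97_1 : certK34L505.hPartOK (PCert.segAt hsegsK34L505 97) JHK34L505 25 11 (18379988629687444034723934350107183942) = true := by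
  decide +kernel

/-- levels `[36, 44)` of segment 97: partial lower sum `≥` claim. [folklore] -/
theorem part_97_2 : certK34L505.hPartOK (PCert.segAt hsegsK34L505 97) JHK34L505 36 8 (5983602668041237704085395682170000542) = true := by
  decide +kernel

/-- levels `[44, 50)` of segment 97: partial lower sum `≥` claim. [folklore] -/
theorem part_97_3 : certK34L505.hPartOK (PCert.segAt hsegsK34L505 97) JHK34L505 44 6 (2136574673458733982302438634370584764) = true := by
  decide +kernel

/-- levels `[50, 55)` of segment 97: partial lower sum `≥` claim. [folklore] -/
theorem part_97_4 : certK34L505.hPartOK (PCert.segAt hsegsK34L505 97) JHK34L505 50 5 (962798424539018234573784330875188202) = true := by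
  decide +kernel

end Literature.MathematicalPhysics.QuantumFieldTheory.ConformalBootstrap3D.PointKernelK34L505
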